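import Literature.MathematicalPhysics.QuantumLattice.LatticeGaugeDLRGibbsProofs
import HarnessLib

/-!
# Zero-temperature limit of the lattice Yang–Mills kernels on a box: freezing on minimisers

Companion of `LatticeGaugeDLRGibbsProofs.lean` (same namespace).  Two results:

* `tendsto_gibbsAverage_atTop_of_isMinOn` — the **abstract Laplace (zero-temperature) concentration
  of Gibbs averages** `∫ g e^{-βS} dμ / ∫ e^{-βS} dμ → c` as `β → ∞`, on a compact space with a finite
  open-positive reference measure, for a continuous `S ≥ 0` with a zero and a continuous `g` that
  equals `c` on the minimisers of `S` (Friedli–Velenik 2017, §1.4.2 and Exercise 6.33 "ground states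
  as zero-temperature limits"; Georgii 2011, Ch. 6 bibliographical notes; elementary ε/2-argument).
  Re-homed general mathematics: the same statement is proved Summit-side as
  `Summit.QuantumFields.YangMills.Theorems.TunedSequenceExists.Negative.Freezing.tendsto_laplaceAverage`
  (for the torus Wilson state); this file makes it importable from `Literature/`.
* `tendsto_integral_ymSpecification_atTop` — **freezing of the Dirichlet box kernels**: for the
  lattice Yang–Mills specification `γ_Λ(· | η) = ymSpecification ρ β Λ η` (product Haar on the
  edges of `Λ`, frozen boundary links `η`, tilted by `exp(-β S_Λ)`), a bounded continuous
  observable `F` that is constant `= c` on the MINIMISERS of the boundary action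
  `ζ ↦ S_Λ(ζ ∨ η)` over the compact fibre `G^Λ` has `∫ F dγ_Λ(· | η) → c` as `β → ∞`
  (Georgii 2011, Def. 2.9 with the integral formula `integral_ymSpecification`; the zero-temperature
  limit of a finite-volume Gibbs distribution with boundary condition concentrates on the
  boundary-condition ground states, Friedli–Velenik 2017, Exercise 6.33).  This is the `β = ∞`
  corner of Dirichlet-box ("femto-universe with frozen walls") statements about one-point functions
  of lattice gauge theory: they reduce to statements about minimisers of the Wilson action with
  Dirichlet data.

No definition and no named fact is introduced.

## References

* S. Friedli, Y. Velenik, *Statistical Mechanics of Lattice Systems* (CUP 2017), §1.4.2,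
  Exercise 6.33, Lemma 6.7.
* H.-O. Georgii, *Gibbs Measures and Phase Transitions*, 2nd ed. (de Gruyter 2011), Def. 2.9, Ch. 6.
-/

noncomputable section

open MeasureTheory Filter Topology
open Literature.Probability.LatticeModels (glueWith)

namespace Literature.MathematicalPhysics.QuantumLattice

/-! ### Abstract zero-temperature concentration of Gibbs averages -/

section Laplace

variable {X : Type*} [TopologicalSpace X] [CompactSpace X] [MeasurableSpace X]
  [OpensMeasurableSpace X]

/-- A continuous real function on a compact space is integrable for a finite measure. [folklore] -/
private theorem integrable_of_continuous_of_compactSpace (μ : Measure X) [IsFiniteMeasure μ] {f : X → ℝ}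
    (hf : Continuous f) : Integrable f μ := by
  obtain ⟨C, hC⟩ := isCompact_univ.exists_bound_of_continuousOn hf.continuousOn
  exact Integrable.of_bound hf.aestronglyMeasurable C (ae_of_all _ fun x => hC x (Set.mem_univ x))

omit [MeasurableSpace X] [OpensMeasurableSpace X] in
/-- Uniform approximation near the zero set (compactness): if `g = c` on `{S = 0}` and `S ≥ 0`
then for every `ε > 0` there is `δ > 0` with `|g x - c| < ε` whenever `S x < δ`. [folklore] -/
private theorem exists_delta_of_eq_on_zeroSet' {S g : X → ℝ} (hS : Continuous S) (hg : Continuous g)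
    {c : ℝ} (hgc : ∀ x, S x = 0 → g x = c) (hS0 : ∀ x, 0 ≤ S x) {ε : ℝ} (hε : 0 < ε) :
    ∃ δ : ℝ, 0 < δ ∧ ∀ x, S x < δ → |g x - c| < ε := by
  set A : Set X := {x | ε ≤ |g x - c|} with hA
  have hAc : IsCompact A :=
    (isClosed_le continuous_const (continuous_abs.comp (hg.sub continuous_const))).isCompact
  by_cases hne : A.Nonempty
  · obtain ⟨x₁, hx₁, hmin⟩ := hAc.exists_isMinOn hne hS.continuousOn
    have hpos : 0 < S x₁ := by
      rcases (hS0 x₁).lt_or_eq with h | h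
      · exact h
      · exfalso
        have hgx : g x₁ = c := hgc x₁ h.symm
        have hx₁' : ε ≤ |g x₁ - c| := hx₁
        rw [hgx, sub_self, abs_zero] at hx₁'
        exact absurd hx₁' (not_le.2 hε)
    refine ⟨S x₁, hpos, fun x hx => ?_⟩
    by_contra hcon
    have hxA : x ∈ A := not_lt.1 hcon
    exact absurd (hmin hxA) (not_le.2 hx)
  · refine ⟨1, one_pos, fun x _ => ?_⟩
    by_contra hcon
    exact hne ⟨x, not_lt.1 hcon⟩

/-- **Zero-temperature concentration of Gibbs averages (abstract Laplace principle).** On a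
compact space with a finite open-positive reference measure `μ`, for a continuous `S ≥ 0` with a
zero and a continuous `g` that is constant `= c` on the zero set of `S`, the Gibbs averages
`∫ g e^{-βS} dμ / ∫ e^{-βS} dμ` tend to `c` as `β → ∞` (Friedli–Velenik 2017, §1.4.2 and
Exercise 6.33; the measure `e^{-βS}μ / Z` concentrates on every neighbourhood `{S < δ}` of the
ground states, which has positive mass by open-positivity).  Private zero-set form (the same
statement is proved Summit-side as `…Negative.Freezing.tendsto_laplaceAverage`); the exported API is
the minimiser form `tendsto_gibbsAverage_atTop_of_isMinOn` below. [cite: FriedliVelenik2017, §1.4.2 and Exercise 6.33] -/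
private theorem tendsto_gibbsAverage_atTop (μ : Measure X) [IsFiniteMeasure μ] [μ.IsOpenPosMeasure]
    {S g : X → ℝ} (hS : Continuous S) (hg : Continuous g) (hS0 : ∀ x, 0 ≤ S x)
    {x₀ : X} (hx₀ : S x₀ = 0) {c : ℝ} (hgc : ∀ x, S x = 0 → g x = c) :
    Tendsto (fun β : ℝ => (∫ x, g x * Real.exp (-β * S x) ∂μ) / (∫ x, Real.exp (-β * S x) ∂μ))
      atTop (𝓝 c) := by
  -- adapted from Summits/QuantumFields/YangMills/Theorems/TunedSequenceExists/Negative/Freezing.lean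
  set w : ℝ → X → ℝ := fun β x => Real.exp (-β * S x) with hw
  have hwc : ∀ β, Continuous (w β) := fun β =>
    Real.continuous_exp.comp (continuous_const.mul hS)
  have hw_pos : ∀ β x, 0 < w β x := fun β x => Real.exp_pos _
  have hw_anti : ∀ β x δ, 0 ≤ β → δ ≤ S x → w β x ≤ Real.exp (-β * δ) := fun β x δ hβ hδ => by
    simp only [hw]
    exact Real.exp_le_exp.2 (by nlinarith)
  have hmass : ∀ δ : ℝ, 0 < δ → 0 < μ.real {x | S x < δ} := fun δ hδ => by
    have hopen : IsOpen {x | S x < δ} := isOpen_lt hS continuous_const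
    have hne : ({x | S x < δ} : Set X).Nonempty := ⟨x₀, by simp [hx₀, hδ]⟩
    exact ENNReal.toReal_pos (hopen.measure_pos μ hne).ne' (measure_ne_top μ _)
  have hZ_ge : ∀ β δ : ℝ, 0 ≤ β → 0 < δ →
      Real.exp (-β * δ) * μ.real {x | S x < δ} ≤ ∫ x, w β x ∂μ := fun β δ hβ hδ => by
    have hms : MeasurableSet {x | S x < δ} := (isOpen_lt hS continuous_const).measurableSet
    calc Real.exp (-β * δ) * μ.real {x | S x < δ}
        = ∫ x, Set.indicator {x | S x < δ} (fun _ => Real.exp (-β * δ)) x ∂μ := by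
          rw [integral_indicator_const _ hms, smul_eq_mul, mul_comm]
      _ ≤ ∫ x, w β x ∂μ := by
          refine integral_mono ?_ (integrable_of_continuous_of_compactSpace μ (hwc β)) fun x => ?_
          · exact (integrable_const _).indicator hms
          · by_cases hx : S x < δ
            · simp only [Set.indicator_of_mem (show x ∈ {x | S x < δ} from hx), hw]
              exact Real.exp_le_exp.2 (by nlinarith [hS0 x])
            · simp only [Set.indicator_of_notMem (show x ∉ {x | S x < δ} from hx)]
              exact (hw_pos β x).le
  have hZ_pos : ∀ β : ℝ, 0 ≤ β → 0 < ∫ x, w β x ∂μ := fun β hβ =>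
    lt_of_lt_of_le (mul_pos (Real.exp_pos _) (hmass 1 one_pos)) (hZ_ge β 1 hβ one_pos)
  obtain ⟨B₀, hB₀⟩ := isCompact_univ.exists_bound_of_continuousOn
    (hg.sub continuous_const : Continuous fun x => g x - c).continuousOn
  set B : ℝ := max B₀ 0 with hB
  have hBnn : 0 ≤ B := le_max_right _ _
  have hgB : ∀ x, |g x - c| ≤ B := fun x =>
    (Real.norm_eq_abs _ ▸ hB₀ x (Set.mem_univ x)).trans (le_max_left _ _)
  refine Metric.tendsto_atTop.2 fun ε hε => ?_
  obtain ⟨δ, hδ, hδε⟩ := exists_delta_of_eq_on_zeroSet' hS hg hgc hS0 (half_pos hε)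
  set m : ℝ := μ.real {x | S x < δ / 2} with hm
  have hm_pos : 0 < m := hmass _ (half_pos hδ)
  set U : ℝ := μ.real Set.univ with hU
  have htail : Tendsto (fun β : ℝ => B * U / m * Real.exp (-β * (δ / 2))) atTop (𝓝 0) := by
    have h1 : Tendsto (fun β : ℝ => -β * (δ / 2)) atTop atBot := by
      have h0 : Tendsto (fun β : ℝ => β * (δ / 2)) atTop atTop :=
        tendsto_id.atTop_mul_const (half_pos hδ)
      refine (tendsto_neg_atTop_atBot.comp h0).congr fun β => ?_
      simp only [Function.comp_apply, neg_mul]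
    have h2 := Real.tendsto_exp_atBot.comp h1
    simpa using h2.const_mul (B * U / m)
  obtain ⟨β₁, hβ₁⟩ := eventually_atTop.1 (htail.eventually (gt_mem_nhds (half_pos hε)))
  refine ⟨max β₁ 0, fun β hβ => ?_⟩
  have hβ0 : 0 ≤ β := le_trans (le_max_right _ _) hβ
  have hβ1 : β₁ ≤ β := le_trans (le_max_left _ _) hβ
  have hZ := hZ_pos β hβ0
  have hpt : ∀ x, |(g x - c) * w β x| ≤ ε / 2 * w β x + B * Real.exp (-β * δ) := fun x => by
    rw [abs_mul, abs_of_pos (hw_pos β x)]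
    by_cases hx : S x < δ
    · have h1 : |g x - c| * w β x ≤ ε / 2 * w β x :=
        mul_le_mul_of_nonneg_right (hδε x hx).le (hw_pos β x).le
      have h2 : 0 ≤ B * Real.exp (-β * δ) := mul_nonneg hBnn (Real.exp_pos _).le
      linarith
    · have h1 : |g x - c| * w β x ≤ B * Real.exp (-β * δ) :=
        mul_le_mul (hgB x) (hw_anti β x δ hβ0 (not_lt.1 hx)) (hw_pos β x).le hBnn
      have h2 : 0 ≤ ε / 2 * w β x := mul_nonneg (half_pos hε).le (hw_pos β x).le
      linarith
  have hint_gw : Integrable (fun x => g x * w β x) μ :=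
    integrable_of_continuous_of_compactSpace μ (hg.mul (hwc β))
  have hint_w : Integrable (w β) μ := integrable_of_continuous_of_compactSpace μ (hwc β)
  have hnum : (∫ x, g x * w β x ∂μ) - c * ∫ x, w β x ∂μ = ∫ x, (g x - c) * w β x ∂μ := by
    rw [← integral_const_mul, ← integral_sub hint_gw (hint_w.const_mul c)]
    refine integral_congr_ae (ae_of_all _ fun x => ?_)
    ring
  have hbound : |(∫ x, g x * w β x ∂μ) - c * ∫ x, w β x ∂μ| ≤
      ε / 2 * (∫ x, w β x ∂μ) + B * Real.exp (-β * δ) * U := by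
    rw [hnum]
    calc |∫ x, (g x - c) * w β x ∂μ| ≤ ∫ x, |(g x - c) * w β x| ∂μ := abs_integral_le_integral_abs
      _ ≤ ∫ x, (ε / 2 * w β x + B * Real.exp (-β * δ)) ∂μ := by
          refine integral_mono ?_ ((hint_w.const_mul _).add (integrable_const _)) hpt
          exact (integrable_of_continuous_of_compactSpace μ
            ((hg.sub continuous_const).mul (hwc β))).abs
      _ = ε / 2 * (∫ x, w β x ∂μ) + B * Real.exp (-β * δ) * U := by
          rw [integral_add (hint_w.const_mul _) (integrable_const _), integral_const_mul,
            integral_const, smul_eq_mul, hU]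
          ring
  have hdiv : |(∫ x, g x * w β x ∂μ) / (∫ x, w β x ∂μ) - c| ≤
      ε / 2 + B * Real.exp (-β * δ) * U / ∫ x, w β x ∂μ := by
    have hZne : (∫ x, w β x ∂μ) ≠ 0 := hZ.ne'
    have hrw : (∫ x, g x * w β x ∂μ) / (∫ x, w β x ∂μ) - c =
        ((∫ x, g x * w β x ∂μ) - c * ∫ x, w β x ∂μ) / ∫ x, w β x ∂μ := by
      field_simp
    rw [hrw, abs_div, abs_of_pos hZ, div_le_iff₀ hZ]
    calc |(∫ x, g x * w β x ∂μ) - c * ∫ x, w β x ∂μ|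
        ≤ ε / 2 * (∫ x, w β x ∂μ) + B * Real.exp (-β * δ) * U := hbound
      _ = (ε / 2 + B * Real.exp (-β * δ) * U / ∫ x, w β x ∂μ) * ∫ x, w β x ∂μ := by
          field_simp
  have htail_le : B * Real.exp (-β * δ) * U / (∫ x, w β x ∂μ) ≤
      B * U / m * Real.exp (-β * (δ / 2)) := by
    have hnum_nn : 0 ≤ B * Real.exp (-β * δ) * U :=
      mul_nonneg (mul_nonneg hBnn (Real.exp_pos _).le) measureReal_nonneg
    have hden : Real.exp (-β * (δ / 2)) * m ≤ ∫ x, w β x ∂μ := hZ_ge β (δ / 2) hβ0 (half_pos hδ)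
    have hden_pos : 0 < Real.exp (-β * (δ / 2)) * m := mul_pos (Real.exp_pos _) hm_pos
    calc B * Real.exp (-β * δ) * U / (∫ x, w β x ∂μ)
        ≤ B * Real.exp (-β * δ) * U / (Real.exp (-β * (δ / 2)) * m) :=
          div_le_div_of_nonneg_left hnum_nn hden_pos hden
      _ = B * U / m * Real.exp (-β * (δ / 2)) := by
          have hsplit : Real.exp (-β * δ) = Real.exp (-β * (δ / 2)) * Real.exp (-β * (δ / 2)) := by
            rw [← Real.exp_add]; ring_nf
          rw [hsplit]
          field_simp
  have htail_lt : B * U / m * Real.exp (-β * (δ / 2)) < ε / 2 := hβ₁ β hβ1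
  rw [Real.dist_eq]
  linarith

/-- The same limit with the energy shifted by its minimum value: if `S` attains its minimum `S x₀`
and `g = c` on the minimisers `{x | ∀ y, S x ≤ S y}`, then the Gibbs averages of `g` tend to `c`
(multiply numerator and denominator by `e^{β S x₀}`). [cite: FriedliVelenik2017, Exercise 6.33] -/
theorem tendsto_gibbsAverage_atTop_of_isMinOn (μ : Measure X) [IsFiniteMeasure μ]
    [μ.IsOpenPosMeasure] {S g : X → ℝ} (hS : Continuous S) (hg : Continuous g) {x₀ : X}
    (hx₀ : ∀ y, S x₀ ≤ S y) {c : ℝ} (hgc : ∀ x, (∀ y, S x ≤ S y) → g x = c) :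
    Tendsto (fun β : ℝ => (∫ x, g x * Real.exp (-β * S x) ∂μ) / (∫ x, Real.exp (-β * S x) ∂μ))
      atTop (𝓝 c) := by
  set T : X → ℝ := fun x => S x - S x₀ with hT
  have hT0 : ∀ x, 0 ≤ T x := fun x => sub_nonneg.2 (hx₀ x)
  have hTc : Continuous T := hS.sub continuous_const
  have hTz : T x₀ = 0 := sub_self _
  have hgT : ∀ x, T x = 0 → g x = c := fun x hx =>
    hgc x fun y => by have := hx₀ y; simp only [hT, sub_eq_zero] at hx; linarith
  have h := tendsto_gibbsAverage_atTop μ hTc hg hT0 hTz hgT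
  refine h.congr fun β => ?_
  have hsplit : ∀ x, Real.exp (-β * T x) = Real.exp (β * S x₀) * Real.exp (-β * S x) := fun x => by
    rw [← Real.exp_add]; simp only [hT]; ring_nf
  simp only [hsplit]
  have hnum : ∫ x, g x * (Real.exp (β * S x₀) * Real.exp (-β * S x)) ∂μ =
      Real.exp (β * S x₀) * ∫ x, g x * Real.exp (-β * S x) ∂μ := by
    rw [← integral_const_mul]
    refine integral_congr_ae (ae_of_all _ fun x => ?_)
    ring
  rw [hnum, integral_const_mul, mul_div_mul_left _ _ (Real.exp_pos _).ne']

end Laplace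

/-! ### Freezing of the Dirichlet box kernels of lattice gauge theory -/

section Box

variable {d N : ℕ} {G : Type*} [Group G] [TopologicalSpace G] [IsTopologicalGroup G]
  [CompactSpace G] [MeasurableSpace G] [BorelSpace G] [SecondCountableTopology G]
  (ρ : G →* Matrix (Fin N) (Fin N) ℂ)

/-- **Freezing of the lattice Yang–Mills box kernels (`β → ∞`).** For the kernel
`γ_Λ(· | η) = ymSpecification ρ β Λ η` with frozen boundary links `η`, a continuous observable `F`
that is constant `= c` on the minimisers of the boundary Wilson action `ζ ↦ S_Λ(ζ ∨ η)` over the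
compact fibre `G^Λ` satisfies `∫ F dγ_Λ(· | η) → c` as `β → ∞`: the finite-volume Gibbs
distribution with boundary condition `η` concentrates on the `η`-ground states (Georgii 2011,
Def. 2.9; Friedli–Velenik 2017, Exercise 6.33). [cite: Georgii2011, Def. 2.9] -/
theorem tendsto_integral_ymSpecification_atTop (hρ : Continuous ρ) (Λ : Finset (ZdEdge d))
    (η : LGConfig d G) {F : LGConfig d G → ℝ} (hF : Continuous F) {c : ℝ}
    (hFc : ∀ ζ : ↥Λ → G,
      (∀ ζ' : ↥Λ → G, wilsonBoundaryAction ρ Λ (glueWith Λ ζ η) ≤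
        wilsonBoundaryAction ρ Λ (glueWith Λ ζ' η)) → F (glueWith Λ ζ η) = c) :
    Tendsto (fun β : ℝ => ∫ U, F U ∂(ymSpecification ρ β Λ η)) atTop (𝓝 c) := by
  haveI : (QuantumFieldTheory.haarProbability G).IsOpenPosMeasure := by
    unfold QuantumFieldTheory.haarProbability; infer_instance
  haveI : IsFiniteMeasure (QuantumFieldTheory.haarProbability G) := by
    unfold QuantumFieldTheory.haarProbability; infer_instance
  -- the energy and the observable on the compact fibre `G^Λ`
  set S : (↥Λ → G) → ℝ := fun ζ => wilsonBoundaryAction ρ Λ (glueWith Λ ζ η) with hS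
  set g : (↥Λ → G) → ℝ := fun ζ => F (glueWith Λ ζ η) with hg
  have hglue : Continuous fun ζ : ↥Λ → G => glueWith Λ ζ η :=
    (continuous_glueWith_prod Λ).comp (Continuous.prodMk_right η)
  have hSc : Continuous S := (continuous_wilsonBoundaryAction ρ hρ Λ).comp hglue
  have hgc' : Continuous g := hF.comp hglue
  obtain ⟨ζ₀, -, hζ₀⟩ := isCompact_univ.exists_isMinOn Set.univ_nonempty hSc.continuousOn
  have hmin : ∀ ζ', S ζ₀ ≤ S ζ' := fun ζ' => hζ₀ (Set.mem_univ ζ')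
  have h := tendsto_gibbsAverage_atTop_of_isMinOn
    (Measure.pi fun _ : ↥Λ => QuantumFieldTheory.haarProbability G) hSc hgc' hmin
    (c := c) (fun ζ hζ => hFc ζ hζ)
  refine h.congr fun β => ?_
  rw [integral_ymSpecification ρ hρ β Λ hF.measurable η]

end Box

end Literature.MathematicalPhysics.QuantumLattice

end
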